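import Literature.Computability.AlgebraicComplexity.ApolarityAction
import Literature.Barriers.ValiantsHypothesis.PartialDerivativesDetPerm
import Literature.RingTheory.MvPolynomial.LeadingExponents
import Mathlib.Data.Nat.Choose.Vandermonde
import Mathlib.LinearAlgebra.FiniteDimensional.Lemmas
import HarnessLib

/-!
# Shafiei 2015, §§1–2: the apolar ideals of the generic determinant and permanent are generated
# in degree two

Topic `Literature/Computability/AlgebraicComplexity` (apolarity of `det_n` / `perm_n`; companion of
`Apolarity.lean`, `ApolarityAction.lean` and of the barrier file
`Literature/Barriers/ValiantsHypothesis/PartialDerivativesDetPerm.lean`, whose permutation-sum and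
canonical-derivative machinery (`permSum`, `canon`, `offGraph`, `sqfree`) is reused). Source:
S. M. Shafiei, *Apolarity for determinants and permanents of generic matrices*, J. Commut. Algebra
**7** (2015) = arXiv:1212.0515 [`Shafiei2015`], held as `paper:arxiv-1212.0515` (TeX chunks
`p0003`–`p0006` = §§1–2; theorem numbers below are the printed ones). Everything here is PROVED
(no named facts); cited as wanted input by the route theses `ValiantsHypothesis/BorderApolarity`
("Cite facts wanted: … Shafiei2015 main theorems (generators of det^⊥, per^⊥)") and
`ValiantsHypothesis/FermionizationDimension` (length `½·binom(2n,n)` via Ranestad–Schreyer).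

## The printed statements (§§1–2) and their Lean form

Setting (p0003): `k` a field, `A = (a_{ij})` the generic `n × n` matrix, `R = k[a_{ij}]`,
`S = k[d_{ij}]` acting on `R` by contraction; `Ann(F) = {Φ ∈ S | Φ ∘ F = 0}` (Def. 1.1, "`Ann(F) ⊂ S`
is an ideal"). In the tree `S` and `R` are the same type `MvPolynomial (Fin n × Fin n) k`, the
action is `apolarAction` (differentiation; it agrees with contraction on the multilinear `det`,
`perm`, so nothing changes — and all results below hold over EVERY commutative ring `k`, the
dimension counts over every field), `Ann(F)` is the set `annihilator F` / the ideal
`annihilatorIdeal F` (this file), `Ann(F)_j` is `annihilatorOfDegree F j` /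
`idealDegree (annihilatorIdeal F) j`.

| source item (chunk) | statement | Lean | status |
|---|---|---|---|
| Def 1.1 (p0003) | `Ann(F)` is an ideal of `S` | `annihilatorIdeal`, `coe_annihilatorIdeal` | def + proved |
| Rem 1.2 (p0003) | `dim V^⊥ = dim S_k − dim V` | `finrank_homogeneousSubmodule_eq_finrank_ann_add` | proved |
| Lemma 1.3 (p0003) | `S_k ∘ det(A) = M_{n−k}(A)` | `apolarAction_accMonomial_permSum`, `map_apolarMap_homogeneousSubmodule` (+ tree `span_derivSet_permSum`) | proved |
| eq. (2.1) (p0004) | `H(S/Ann(det A))_k = H(S/Ann(Perm A))_k = binom(n,k)²` | `hilbertFunction_annihilatorIdeal_detPoly/_perPoly`, `finrank_map_apolarMap_detPoly/_perPoly` | proved |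
| eq. (2.2) (p0004) | `dim_k 𝔄_A = Σ binom(n,k)² = binom(2n,n)` | `sum_hilbertFunction_annihilatorIdeal_detPoly/_perPoly` | proved |
| Lemma 2.2 (p0004) | each `2 × 2` permanent of `D` annihilates `det(A)` | `apolarAction_twoByTwoPerm_detPoly`, engine `apolarAction_crossRel_permSum_eq_zero` | proved |
| Def 2.3 (p0004) | `𝒫_D`, `ℳ_D` (2 × 2 permanents / minors of `D`) | `twoByTwoPerms`, `twoByTwoMinors` | defs |
| Def 2.5 (p0004) | acceptable / unacceptable monomials, `𝒰_D` | `unacceptableQuadrics`, `accMonomial`, `monomial_mem_span_unacceptable_or_exists` | defs + proved |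
| Lemma 2.9 (p0005) | `(𝒫_D + 𝒰_D)_k ⊆ Ann(M_k(A)) ∩ S_k` | `apolarAction_permSum_eq_zero_of_mem_relIdeal` | proved |
| Prop 2.10 (p0005) | `(𝒫_D + 𝒰_D)_n = Ann(det A) ∩ S_n` | `mem_relIdeal_of_apolarAction_permSum_eq_zero` (all degrees at once) | proved |
| Cor 2.11 (p0006) | `(𝒫_D + 𝒰_D)_k = Ann(det A) ∩ S_k` (`1 ≤ k ≤ n`); `(𝒰_D)_{n+1} = S_{n+1}` | `annihilatorOfDegree_detPoly`, `annihilatorOfDegree_detPoly_of_lt`, `mem_span_unacceptable_of_isHomogeneous` | proved |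
| **Thm 2.12** (p0006) | `Ann(det A) = (𝒫_D + 𝒰_D)`, generated in degree two | **`annihilatorIdeal_detPoly`**, `annihilator_detPoly`, `isHomogeneous_two_of_mem_generators` | proved |
| **Thm 2.13** (p0006) | `Ann(Per A) = (ℳ_D + 𝒰_D)`, generated in degree two | **`annihilatorIdeal_perPoly`**, `annihilator_perPoly` | proved |
| §2.1 (p0004) | `H_0 = 1`, `H_1 = n²` (no annihilators of degree `≤ 1`) | `eq_zero_of_mem_annihilatorOfDegree_detPoly_of_le_one` (and `_perPoly_`) | proved |
| Lemma 2.7 + Rem 1.5 / Cor 2.4 (p0005) | `Ann(det A) ∩ S_2 = 𝒫_D + 𝒰_D` (vector spaces) | `annihilatorOfDegree_detPoly_two` (and `_perPoly_two`) | proved |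
| Def 1.1 (p0003) | `Ann(F) = ⊕_k Ann(F)_k` is graded | `homogeneousComponent_mem_annihilatorIdeal` (any form), `…_detPoly` | proved |

Not typed here: Lemma 2.6 (the direct sum `𝒫_D ⊕ ℳ_D =` acceptable quadrics, needs `char k ≠ 2`;
not used by the main theorems in this organisation), Rem 2.8, Cor 2.14 (maximal minors of an
`m × n` matrix), §3 (ranks: Ranestad–Schreyer Prop 3.4 and Thm 3.5 `cr(det_n) ≥ ½ binom(2n,n)`
are statements about zero-dimensional apolar SCHEMES — a different layer; §3 only combines Thm
2.12/2.13 and eq. (2.2) with [RS]), §4 (Pfaffians and Hafnians — another section/file).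

## Proof route (disclosed deviation in organisation, not in content)

Shafiei proves `⊇` in Prop 2.10 by an induction on `n` over binomials `b₁ + b₂` of determinant
terms and lifts it to all degrees in Cor 2.11 through `Ann(det A)_k = Ann(M_k(A))_k`. Here one
ENGINE handles `det` and `perm` and all degrees at once: for a permutation sum
`F = ∑_π c(π) ∏ᵢ a_{π i,i}` with `c` multiplicative, `c(1) = 1` and `c = ε` on transpositions
(`sgn, ε = -1` / `1, ε = 1`), (i) the unacceptable quadrics and the cross relations
`d_{ij}d_{i'j'} - ε d_{ij'}d_{i'j}` kill `F` (Lemma 2.2's pairing `σ ↦ (j j')σ`,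
`apolarAction_crossRel_permSum_eq_zero`); (ii) every monomial is unacceptable (hence in `(𝒰_D)`)
or acceptable `∏_{b ∈ B} d_{π b,b}` (`monomial_mem_span_unacceptable_or_exists`); (iii) acceptable
monomials with the same row set and column set are congruent, modulo the ideal, up to the factor
`c(τ)` of the connecting column permutation `τ` (transposition induction,
`accMonomial_mul_ofSubtype_sub_smul_mem` — this is the binomial step of Prop 2.10); (iv) the apolar
image of `∏_{b∈B} d_{π b,b}` is the canonical derivative `canon c π B` (`±` complementary minor /
sub-permanent; Lemma 1.3) and distinct (row set, column set) classes have disjoint leading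
monomials (`coeff_sqfree_offGraph_canon_eq_zero`, §2.1's linear independence of minors); so if
`D ∘ F = 0`, the coefficients of `D` on each class, weighted by `c(τ)`, sum to zero and the class
sum lies in the ideal — induction on the number of acceptable monomials of `D`
(`mem_relIdeal_of_apolarAction_permSum_eq_zero`). No use of `char k`; valid over every
commutative ring. The dimension statements (Rem 1.2, eq. (2.1)–(2.2)) are rank–nullity for the
apolar map `apolarMap F : Φ ↦ Φ ∘ F` on `S_j` plus the tree's `flatteningRank_detPoly/_perPoly`.

Honest framing: a theorem of commutative algebra about `det_n` and `perm_n`, symmetric between the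
two (both apolar ideals are generated by quadrics with the same Hilbert function); it is recorded
by the routes as an INPUT and is no progress on `VP ≠ VNP`.

## References

* S. M. Shafiei, *Apolarity for determinants and permanents of generic matrices*, J. Commut.
  Algebra 7 (2015), no. 1; arXiv:1212.0515. [`Shafiei2015`]
* K. Ranestad, F.-O. Schreyer, *On the rank of a symmetric form*, J. Algebra 346 (2011) 340–342
  (the application in §3, not typed). [`RanestadSchreyer2011`]
* A. Iarrobino, V. Kanev, *Power sums, Gorenstein algebras, and determinantal loci*, LNM 1721
  (1999), §1.1 (apolarity). [`IarrobinoKanev1999`]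
* J. M. Landsberg, *Geometry and complexity theory*, CUP 2017, §10.1.2, Exercise 6.2.2.7
  (flattening ranks of `det_n`, `perm_n`). [`LandsbergGCT2017`]
-/

noncomputable section

open MvPolynomial Finset

namespace Literature.Computability.AlgebraicComplexity

open Literature.Barriers.ValiantsHypothesis

/-! ### The annihilator is an ideal -/

section AnnIdeal

variable {σ : Type*} {k : Type*} [CommRing k]

/-- The **apolar ideal** `Ann(F) = {Φ ∈ S | Φ ∘ F = 0}` as an `Ideal` of the operator ring
(Shafiei 2015, Def. 1.1: "`I = Ann(F)` in `S = k[d_{ij}]` consisting of polynomials `Φ` such that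
`Φ ∘ F = 0` … `Ann(F) ⊂ S` is an ideal"); its carrier is the tree's set `annihilator F`
(`Apolarity.lean`, Landsberg 2017 §10.1.2), the ideal axioms come from bilinearity and
multiplicativity of `apolarAction` (`ApolarityAction.lean`). [cite: Shafiei2015, Definition 1.1] -/
def annihilatorIdeal (f : MvPolynomial σ k) : Ideal (MvPolynomial σ k) where
  carrier := annihilator f
  zero_mem' := apolarAction_zero_left f
  add_mem' := fun {D E} hD hE => by
    rw [mem_annihilator_iff] at hD hE ⊢
    rw [apolarAction_add_left, hD, hE, add_zero]
  smul_mem' := fun c D hD => by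
    rw [mem_annihilator_iff] at hD ⊢
    rw [smul_eq_mul, apolarAction_mul, hD, apolarAction_zero_right]

/-- Membership in the apolar ideal: `D ∈ Ann(f) ↔ D ⌟ f = 0`. [cite: Shafiei2015, Definition 1.1] -/
@[simp] theorem mem_annihilatorIdeal_iff {f D : MvPolynomial σ k} :
    D ∈ annihilatorIdeal f ↔ apolarAction D f = 0 := Iff.rfl

/-- The carrier of the apolar ideal is the tree's `annihilator`. [cite: Shafiei2015, Definition 1.1] -/
theorem coe_annihilatorIdeal (f : MvPolynomial σ k) :
    (annihilatorIdeal f : Set (MvPolynomial σ k)) = annihilator f := rfl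

/-- The degree-`j` annihilator is the degree-`j` part of the apolar ideal:
`Ann(F)_j = {h ∈ S_j | h ∘ F = 0}`. [cite: Shafiei2015, Definition 1.1] -/
theorem annihilatorOfDegree_eq_sep (f : MvPolynomial σ k) (j : ℕ) :
    annihilatorOfDegree f j = {D | D.IsHomogeneous j ∧ D ∈ annihilatorIdeal f} := rfl

end AnnIdeal

/-! ### Operators that are products of variables act as iterated partial derivatives -/

section Bridge

variable {σ : Type*} {k : Type*} [CommRing k]

/-- `(∂_{a₁} ⋯ ∂_{a_r}) ⌟ f` is the iterated partial derivative along the list. [folklore] -/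
private theorem apolarAction_listProd_X (l : List σ) (f : MvPolynomial σ k) :
    apolarAction (l.map X).prod f = iterPDeriv l f := by
  induction l with
  | nil =>
    rw [List.map_nil, List.prod_nil, iterPDeriv_nil, ← C_1, apolarAction_C, one_smul]
  | cons a l ih =>
    rw [List.map_cons, List.prod_cons, apolarAction_X_mul, ih, apolarAction_X, iterPDeriv_cons]

/-- `(∏_{a ∈ T} ∂_a) ⌟ f = ∂_T f`, the iterated derivative along (any listing of) `T`. [folklore] -/
private theorem apolarAction_prod_X (T : Finset σ) (f : MvPolynomial σ k) :
    apolarAction (∏ a ∈ T, X a) f = iterPDeriv T.toList f := by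
  rw [← apolarAction_listProd_X, Finset.prod_map_toList]

end Bridge

/-! ### The generators: unacceptable quadrics, `2 × 2` permanents and minors of `D = (d_{ij})` -/

section Generators

variable (n : ℕ) (k : Type*) [CommRing k]

/-- Shafiei's **unacceptable monomials of degree two** `𝒰_D`: "the square of an element, or any
product of two … elements of the same row or column of `D`" — the products `d_a d_b` of two
variables `a = (i,j)`, `b = (i',j')` with `i = i'` or `j = j'` (squares included, `a = b`). A monomial
is *acceptable* iff it is square free with no two variables from the same row or column
(Def. 2.5). [cite: Shafiei2015, Definition 2.5] -/
def unacceptableQuadrics : Set (MvPolynomial (Fin n × Fin n) k) :=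
  {q | ∃ a b : Fin n × Fin n, (a.1 = b.1 ∨ a.2 = b.2) ∧ q = X a * X b}

/-- The set `{𝒫_D}` of **`2 × 2` permanents** `d_{ij} d_{i'j'} + d_{ij'} d_{i'j}` (`i ≠ i'`, `j ≠ j'`)
of the matrix of dual variables `D = (d_{ij})` (Shafiei 2015, Def. 2.3). [cite: Shafiei2015, Definition 2.3] -/
def twoByTwoPerms : Set (MvPolynomial (Fin n × Fin n) k) :=
  {q | ∃ i i' j j' : Fin n, i ≠ i' ∧ j ≠ j' ∧ q = X (i, j) * X (i', j') + X (i, j') * X (i', j)}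

/-- The set `{ℳ_D}` of **`2 × 2` minors** `d_{ij} d_{i'j'} - d_{ij'} d_{i'j}` (`i ≠ i'`, `j ≠ j'`) of
the matrix of dual variables `D = (d_{ij})` (Shafiei 2015, Def. 2.3). [cite: Shafiei2015, Definition 2.3] -/
def twoByTwoMinors : Set (MvPolynomial (Fin n × Fin n) k) :=
  {q | ∃ i i' j j' : Fin n, i ≠ i' ∧ j ≠ j' ∧ q = X (i, j) * X (i', j') - X (i, j') * X (i', j)}

/-- The one-parameter family of **cross relations** `d_{ij} d_{i'j'} - ε · d_{ij'} d_{i'j}`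
(`i ≠ i'`, `j ≠ j'`) interpolating the `2 × 2` permanents (`ε = -1`) and minors (`ε = 1`); the
engine below treats the determinant and the permanent uniformly through it. [folklore] -/
def crossRel (ε : k) : Set (MvPolynomial (Fin n × Fin n) k) :=
  {q | ∃ i i' j j' : Fin n, i ≠ i' ∧ j ≠ j' ∧ q = X (i, j) * X (i', j') - ε • (X (i, j') * X (i', j))}

/-- `ε = -1`: the cross relations are the `2 × 2` permanents. [cite: Shafiei2015, Definition 2.3] -/
theorem crossRel_neg_one : crossRel n k (-1) = twoByTwoPerms n k := by
  ext q
  simp only [crossRel, twoByTwoPerms, Set.mem_setOf_eq, neg_smul, one_smul, sub_neg_eq_add]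

/-- `ε = 1`: the cross relations are the `2 × 2` minors. [cite: Shafiei2015, Definition 2.3] -/
theorem crossRel_one : crossRel n k 1 = twoByTwoMinors n k := by
  ext q
  simp only [crossRel, twoByTwoMinors, Set.mem_setOf_eq, one_smul]

variable {n k}

/-- The **acceptable monomial** `∏_{b ∈ B} d_{π b, b}` with column set `B` and rows read off a
permutation `π` (square free, distinct rows, distinct columns — Shafiei's acceptable monomials,
Def. 2.5, in the indexing of the tree's canonical derivatives `canon c π B`). [cite: Shafiei2015, Definition 2.5] -/
def accMonomial (π : Equiv.Perm (Fin n)) (B : Finset (Fin n)) : MvPolynomial (Fin n × Fin n) k :=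
  ∏ b ∈ B, X (π b, b)

/-- An acceptable monomial is the square-free monomial on the graph of `π` over `B` (Def. 2.5:
"square free and has no two variables from the same row or column"). [cite: Shafiei2015, Definition 2.5] -/
theorem accMonomial_eq_monomial (π : Equiv.Perm (Fin n)) (B : Finset (Fin n)) :
    (accMonomial π B : MvPolynomial (Fin n × Fin n) k) = monomial (sqfree (B.map (grEmb π))) 1 := by
  rw [accMonomial, sqfree, Finset.sum_map, monomial_sum_one]
  rfl

end Generators

/-! ### Partial permutation matrices extend to permutations -/

section Extend

variable {n : ℕ}

/-- A set of positions `T` with pairwise distinct rows and pairwise distinct columns is (part of)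
the graph of a permutation: some `π` has `π(col) = row` on every position of `T`. [folklore] -/
private theorem exists_perm_apply_snd_eq_fst (T : Finset (Fin n × Fin n))
    (hrow : ∀ a ∈ T, ∀ b ∈ T, a.1 = b.1 → a = b) (hcol : ∀ a ∈ T, ∀ b ∈ T, a.2 = b.2 → a = b) :
    ∃ π : Equiv.Perm (Fin n), ∀ t ∈ T, π t.2 = t.1 := by
  classical
  let B : Finset (Fin n) := T.image Prod.snd
  let R : Finset (Fin n) := T.image Prod.fst
  let f₂ : {t // t ∈ T} → {b // b ∈ B} := fun t => ⟨t.1.2, Finset.mem_image_of_mem _ t.2⟩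
  let f₁ : {t // t ∈ T} → {r // r ∈ R} := fun t => ⟨t.1.1, Finset.mem_image_of_mem _ t.2⟩
  have hf₂ : Function.Bijective f₂ := by
    refine ⟨fun t t' h => Subtype.ext (hcol _ t.2 _ t'.2 (Subtype.ext_iff.1 h)), fun b => ?_⟩
    obtain ⟨t, ht, htb⟩ := Finset.mem_image.1 b.2
    exact ⟨⟨t, ht⟩, Subtype.ext htb⟩
  have hf₁ : Function.Bijective f₁ := by
    refine ⟨fun t t' h => Subtype.ext (hrow _ t.2 _ t'.2 (Subtype.ext_iff.1 h)), fun r => ?_⟩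
    obtain ⟨t, ht, htr⟩ := Finset.mem_image.1 r.2
    exact ⟨⟨t, ht⟩, Subtype.ext htr⟩
  let e : {b // b ∈ B} ≃ {r // r ∈ R} :=
    (Equiv.ofBijective f₂ hf₂).symm.trans (Equiv.ofBijective f₁ hf₁)
  refine ⟨e.extendSubtype, fun t ht => ?_⟩
  have htB : t.2 ∈ B := Finset.mem_image_of_mem _ ht
  rw [e.extendSubtype_apply_of_mem _ htB]
  have h2 : (Equiv.ofBijective f₂ hf₂).symm ⟨t.2, htB⟩ = ⟨t, ht⟩ := by
    apply (Equiv.ofBijective f₂ hf₂).injective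
    rw [Equiv.apply_symm_apply, Equiv.ofBijective_apply]
  change (f₁ ((Equiv.ofBijective f₂ hf₂).symm ⟨t.2, htB⟩)).1 = t.1
  rw [h2]

/-- Two prescribed values: for `i ≠ i'` and `j ≠ j'` some permutation has `π j = i`, `π j' = i'`.
[folklore] -/
private theorem exists_perm_apply_eq_pair {i i' j j' : Fin n} (hi : i ≠ i') (hj : j ≠ j') :
    ∃ π : Equiv.Perm (Fin n), π j = i ∧ π j' = i' := by
  classical
  obtain ⟨π, hπ⟩ := exists_perm_apply_snd_eq_fst ({(i, j), (i', j')} : Finset (Fin n × Fin n))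
    (by
      intro a ha b hb h
      simp only [Finset.mem_insert, Finset.mem_singleton] at ha hb
      rcases ha with rfl | rfl <;> rcases hb with rfl | rfl <;> first | rfl | (exact absurd h hi) |
        (exact absurd h.symm hi))
    (by
      intro a ha b hb h
      simp only [Finset.mem_insert, Finset.mem_singleton] at ha hb
      rcases ha with rfl | rfl <;> rcases hb with rfl | rfl <;> first | rfl | (exact absurd h hj) |
        (exact absurd h.symm hj))
  exact ⟨π, hπ (i, j) (by simp), hπ (i', j') (by simp)⟩

end Extend

/-! ### Canonical derivatives and acceptable monomials under a permutation of the columns -/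

section Canon

variable {n : ℕ} {k : Type*} [CommRing k] (c : Equiv.Perm (Fin n) → k)

/-- A permutation fixing the complement of `B` pointwise maps `B` onto itself. [folklore] -/
private theorem mem_iff_apply_mem_of_support {B : Finset (Fin n)} {τ : Equiv.Perm (Fin n)}
    (hτ : ∀ i, i ∉ B → τ i = i) (b : Fin n) : b ∈ B ↔ τ b ∈ B := by
  constructor
  · intro hb
    by_contra h
    have h1 : τ (τ b) = τ b := hτ _ h
    rw [τ.injective h1] at h
    exact h hb
  · intro hb
    by_contra h
    exact h (by rwa [← hτ _ h])

/-- **Reindexing a canonical derivative**: composing `π₀` with a permutation `τ` of the column set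
`B` (identity off `B`) multiplies the canonical derivative `∑_{π|_B = π₀|_B} c(π) x^{offGraph π B}`
by `c(τ)` — for the determinant the sign of `τ`, for the permanent `1` (the explicit form of the
tree's `canon_eq_smul_canon`; the `±` of Shafiei's Lemma 1.3, "`M_{Î,Ĵ} = ± (d_{i₁j₁} ⋯ d_{i_kj_k}) ∘ det(A)`").
[cite: Shafiei2015, Lemma 1.3] -/
theorem canon_mul_of_support (hmul : ∀ π τ, c (π * τ) = c π * c τ) (π₀ τ : Equiv.Perm (Fin n))
    (B : Finset (Fin n)) (hτ : ∀ i, i ∉ B → τ i = i) :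
    canon c (π₀ * τ) B = c τ • canon c π₀ B := by
  classical
  have hB := mem_iff_apply_mem_of_support hτ
  rw [canon, canon, Finset.sum_filter, Finset.sum_filter, Finset.smul_sum]
  rw [← Fintype.sum_equiv (Equiv.mulRight τ)
    (fun π => if ∀ b ∈ B, (π * τ) b = (π₀ * τ) b then
      monomial (sqfree (offGraph (π * τ) B)) (c (π * τ)) else 0) _ (fun π => rfl)]
  refine Finset.sum_congr rfl fun π _ => ?_
  have hcond : (∀ b ∈ B, (π * τ) b = (π₀ * τ) b) ↔ ∀ b ∈ B, π b = π₀ b := by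
    simp only [Equiv.Perm.coe_mul, Function.comp_apply]
    constructor
    · intro h b hb
      have h1 := h (τ.symm b) (by rw [hB, Equiv.apply_symm_apply]; exact hb)
      rwa [Equiv.apply_symm_apply] at h1
    · intro h b hb
      exact h _ ((hB b).1 hb)
  by_cases h : ∀ b ∈ B, π b = π₀ b
  · rw [if_pos (hcond.2 h), if_pos h, offGraph_mul_eq hτ, hmul, smul_monomial, smul_eq_mul, mul_comm]
  · rw [if_neg (fun h' => h (hcond.1 h')), if_neg h, smul_zero]

/-- **The apolar image of an acceptable monomial** on a permutation sum is the canonical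
derivative: `(∏_{b ∈ B} d_{π b, b}) ∘ (∑_ρ c(ρ) ∏ᵢ a_{ρ i, i}) = ∑_{ρ|_B = π|_B} c(ρ) ∏_{i ∉ B} a_{ρ i,i}`
(Shafiei 2015, proof of Lemma 1.3: "`M_{Î,Ĵ} = ± (d_{i₁j₁} ⋯ d_{i_kj_k}) ∘ det A`").
[cite: Shafiei2015, Lemma 1.3] -/
theorem apolarAction_accMonomial_permSum (π : Equiv.Perm (Fin n)) (B : Finset (Fin n)) :
    apolarAction (accMonomial π B) (permSum c) = canon c π B := by
  classical
  have h : (accMonomial π B : MvPolynomial (Fin n × Fin n) k) = ∏ a ∈ B.map (grEmb π), X a := by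
    rw [accMonomial, Finset.prod_map]; rfl
  rw [h, apolarAction_prod_X]
  exact iterPDeriv_permSum c π B _ (Finset.nodup_toList _) (Finset.toList_toFinset _)

/-- **Unacceptable quadrics annihilate**: `d_a d_b ∘ F = 0` for two variables in the same row or
column (or equal) and `F` any permutation sum — no term of `det`/`perm` contains two entries of one
row or column (Shafiei 2015, before Def. 2.5: "the square of an element, or any product of two or
more elements of the same row or column of `D` annihilates `det(A)`"). [cite: Shafiei2015, Definition 2.5] -/
theorem apolarAction_X_mul_X_permSum_eq_zero {a b : Fin n × Fin n} (hab : a.1 = b.1 ∨ a.2 = b.2) :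
    apolarAction (X a * X b) (permSum c) = 0 := by
  classical
  have h : (X a * X b : MvPolynomial (Fin n × Fin n) k) = ([a, b].map X).prod := by simp
  rw [h, apolarAction_listProd_X]
  refine iterPDeriv_permSum_eq_zero c _ fun π ⟨hnd, hmem⟩ => ?_
  have ha := (mem_offGraph.1 (hmem a (by simp))).2
  have hb := (mem_offGraph.1 (hmem b (by simp))).2
  have hne : a ≠ b := by
    intro h; rw [h] at hnd; simp at hnd
  apply hne
  rcases hab with h1 | h2
  · have : a.2 = b.2 := π.injective (by rw [ha, hb, h1])
    exact Prod.ext h1 this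
  · exact Prod.ext (by rw [← ha, ← hb, h2]) h2

/-- An acceptable monomial on two columns. [folklore] -/
private theorem accMonomial_pair {j j' : Fin n} (hj : j ≠ j') (π : Equiv.Perm (Fin n)) :
    (accMonomial π {j, j'} : MvPolynomial (Fin n × Fin n) k) = X (π j, j) * X (π j', j') := by
  classical
  rw [accMonomial, Finset.prod_pair hj]

/-- **The cross relations annihilate** (Shafiei 2015, Lemma 2.2 for the determinant: "each `2 × 2`
permanent of `D` annihilates the determinant of `A`" — the terms containing `a_{ij}a_{kl}` and
those containing `a_{il}a_{kj}` correspond under `σ ↦ (j l)σ` with opposite signs; the same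
bijection with equal signs gives the `2 × 2` minors on the permanent, proof of Thm. 2.13). Here
for a permutation sum with multiplicative coefficients taking the value `ε` on transpositions,
`ε² = 1`. [cite: Shafiei2015, Lemma 2.2] -/
theorem apolarAction_crossRel_permSum_eq_zero (hmul : ∀ π τ, c (π * τ) = c π * c τ)
    (hone : c 1 = 1) {ε : k} (hε : ∀ a b : Fin n, a ≠ b → c (Equiv.swap a b) = ε)
    {i i' j j' : Fin n} (hi : i ≠ i') (hj : j ≠ j') :
    apolarAction (X (i, j) * X (i', j') - ε • (X (i, j') * X (i', j))) (permSum c) = 0 := by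
  classical
  obtain ⟨π₀, h0, h0'⟩ := exists_perm_apply_eq_pair hi hj
  have hε2 : ε * ε = 1 := by
    rw [← hε j j' hj, ← hmul, Equiv.swap_mul_self, hone]
  have h1 : (X (i, j) * X (i', j') : MvPolynomial (Fin n × Fin n) k) = accMonomial π₀ {j, j'} := by
    rw [accMonomial_pair hj, h0, h0']
  have h2 : (X (i, j') * X (i', j) : MvPolynomial (Fin n × Fin n) k) =
      accMonomial (π₀ * Equiv.swap j j') {j, j'} := by
    rw [accMonomial_pair hj, Equiv.Perm.coe_mul, Function.comp_apply, Function.comp_apply,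
      Equiv.swap_apply_left, Equiv.swap_apply_right, h0, h0', mul_comm]
  have hτ : ∀ x, x ∉ ({j, j'} : Finset (Fin n)) → Equiv.swap j j' x = x := by
    intro x hx
    simp only [Finset.mem_insert, Finset.mem_singleton, not_or] at hx
    exact Equiv.swap_apply_of_ne_of_ne hx.1 hx.2
  rw [apolarAction_sub_left, apolarAction_smul_left, h1, h2, apolarAction_accMonomial_permSum,
    apolarAction_accMonomial_permSum, canon_mul_of_support c hmul π₀ _ _ hτ, hε j j' hj, smul_smul,
    hε2, one_smul, sub_self]

end Canon

/-! ### Rewriting acceptable monomials modulo the degree-two relations -/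

section Rewrite

variable {n : ℕ} {k : Type*} [CommRing k] (c : Equiv.Perm (Fin n) → k) (ε : k)

/-- The ideal `(𝒰_D + cross relations)` of the engine (`= (𝒫_D + 𝒰_D)` for `ε = -1`,
`= (ℳ_D + 𝒰_D)` for `ε = 1`). [folklore] -/
abbrev relIdeal (n : ℕ) (k : Type*) [CommRing k] (ε : k) : Ideal (MvPolynomial (Fin n × Fin n) k) :=
  Ideal.span (unacceptableQuadrics n k ∪ crossRel n k ε)

/-- Scalar multiples stay in an ideal of the polynomial ring. [folklore] -/
private theorem smul_mem_ideal {σ : Type*} (I : Ideal (MvPolynomial σ k)) (a : k)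
    {x : MvPolynomial σ k} (hx : x ∈ I) : a • x ∈ I := by
  rw [smul_eq_C_mul]; exact I.mul_mem_left _ hx

/-- **One transposition**: exchanging the rows above two columns `x ≠ y` of an acceptable monomial
changes it, modulo a multiple of one cross relation, by the factor `ε`:
`∏_b d_{π(x y) b, b} - ε ∏_b d_{π b, b} = (d_{π y,x} d_{π x,y} - ε d_{π y,y} d_{π x,x}) · ∏_{b ≠ x,y} d_{π b,b}`
(the binomial step of Shafiei 2015, Prop. 2.10). [cite: Shafiei2015, Proposition 2.10] -/
theorem accMonomial_mul_swap_sub_smul_mem (π : Equiv.Perm (Fin n)) {B : Finset (Fin n)}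
    {x y : Fin n} (hxy : x ≠ y) (hx : x ∈ B) (hy : y ∈ B) :
    accMonomial (π * Equiv.swap x y) B - ε • accMonomial π B ∈ relIdeal n k ε := by
  classical
  have hy' : y ∈ B.erase x := Finset.mem_erase.2 ⟨hxy.symm, hy⟩
  have split : ∀ g : Fin n → MvPolynomial (Fin n × Fin n) k,
      ∏ b ∈ B, g b = g x * g y * ∏ b ∈ (B.erase x).erase y, g b := by
    intro g
    rw [← Finset.mul_prod_erase B g hx, ← Finset.mul_prod_erase _ g hy', mul_assoc]
  have hrest : ∏ b ∈ (B.erase x).erase y, (X ((π * Equiv.swap x y) b, b) : MvPolynomial _ k) =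
      ∏ b ∈ (B.erase x).erase y, X (π b, b) := by
    refine Finset.prod_congr rfl fun b hb => ?_
    simp only [Finset.mem_erase] at hb
    rw [Equiv.Perm.coe_mul, Function.comp_apply, Equiv.swap_apply_of_ne_of_ne hb.2.1 hb.1]
  rw [accMonomial, accMonomial, split, split, hrest, Equiv.Perm.coe_mul, Function.comp_apply,
    Function.comp_apply, Equiv.swap_apply_left, Equiv.swap_apply_right, ← smul_mul_assoc, ← sub_mul]
  refine Ideal.mul_mem_right _ _ (Ideal.subset_span (Or.inr ⟨π y, π x, x, y, ?_, hxy, ?_⟩))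
  · exact fun h => hxy (π.injective h).symm
  · rw [mul_comm (X (π x, x))]

/-- **Any permutation of the columns** (Shafiei 2015, Prop. 2.10 / Cor. 2.11, the induction on
binomials, organised as an induction on transpositions): for a permutation `τ` of the column set
`B`, `∏_b d_{(π τ) b, b} ≡ c(τ) ∏_b d_{π b, b}` modulo `(𝒰_D + cross relations)`, where `c` is
multiplicative with value `ε` on transpositions (`sgn` resp. `1`). [cite: Shafiei2015, Proposition 2.10] -/
theorem accMonomial_mul_ofSubtype_sub_smul_mem (hmul : ∀ π τ, c (π * τ) = c π * c τ)
    (hone : c 1 = 1) (hε : ∀ a b : Fin n, a ≠ b → c (Equiv.swap a b) = ε) (B : Finset (Fin n))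
    (τ : Equiv.Perm {x // x ∈ B}) (π : Equiv.Perm (Fin n)) :
    accMonomial (π * Equiv.Perm.ofSubtype τ) B - c (Equiv.Perm.ofSubtype τ) • accMonomial π B ∈
      relIdeal n k ε := by
  classical
  induction τ using Equiv.Perm.swap_induction_on generalizing π with
  | one => rw [map_one, mul_one, hone, one_smul, sub_self]; exact Ideal.zero_mem _
  | swap_mul f x y hxy ih =>
    have hxy' : (x : Fin n) ≠ y := fun h => hxy (Subtype.ext h)
    rw [map_mul, Equiv.Perm.ofSubtype_swap_eq, ← mul_assoc, hmul, hε _ _ hxy']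
    have key : accMonomial (π * Equiv.swap (x : Fin n) y * Equiv.Perm.ofSubtype f) B -
        (ε * c (Equiv.Perm.ofSubtype f)) • accMonomial π B =
        (accMonomial (π * Equiv.swap (x : Fin n) y * Equiv.Perm.ofSubtype f) B -
          c (Equiv.Perm.ofSubtype f) • accMonomial (π * Equiv.swap (x : Fin n) y) B) +
        c (Equiv.Perm.ofSubtype f) • (accMonomial (π * Equiv.swap (x : Fin n) y) B -
          ε • (accMonomial π B : MvPolynomial (Fin n × Fin n) k)) := by
      rw [smul_sub, smul_smul, mul_comm (c _) ε]; abel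
    rw [key]
    exact Ideal.add_mem _ (ih _)
      (smul_mem_ideal _ _ (accMonomial_mul_swap_sub_smul_mem ε π hxy' x.2 y.2))

end Rewrite

/-! ### Every monomial is unacceptable or acceptable -/

section Trichotomy

variable {n : ℕ} {k : Type*} [CommRing k]

/-- A monomial divisible by an unacceptable quadric lies in `(𝒰_D)`. [folklore] -/
private theorem monomial_mem_span_of_le {d : Fin n × Fin n →₀ ℕ} {a b : Fin n × Fin n}
    (hab : a.1 = b.1 ∨ a.2 = b.2) (hle : Finsupp.single a 1 + Finsupp.single b 1 ≤ d) (r : k) :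
    monomial d r ∈ Ideal.span (unacceptableQuadrics n k) := by
  have hd : d = (Finsupp.single a 1 + Finsupp.single b 1) + (d - (Finsupp.single a 1 + Finsupp.single b 1)) :=
    (add_tsub_cancel_of_le hle).symm
  have hm : monomial d r = X a * X b * monomial (d - (Finsupp.single a 1 + Finsupp.single b 1)) r := by
    conv_lhs => rw [hd]
    rw [X, X, monomial_mul, monomial_mul, one_mul, one_mul]
  rw [hm]
  exact Ideal.mul_mem_right _ _ (Ideal.subset_span ⟨a, b, hab, rfl⟩)

/-- **Dichotomy of monomials** (Shafiei 2015, Def. 2.5): a monomial in the `d_{ij}` either has a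
square or two variables from one row or one column — and then lies in the ideal `(𝒰_D)` of
unacceptable quadrics — or it is *acceptable*: square free with distinct rows and distinct
columns, i.e. `∏_{b ∈ B} d_{π b, b}` for a column set `B` and a permutation `π`.
[cite: Shafiei2015, Definition 2.5] -/
theorem monomial_mem_span_unacceptable_or_exists (d : Fin n × Fin n →₀ ℕ) (r : k) :
    monomial d r ∈ Ideal.span (unacceptableQuadrics n k) ∨
      ∃ (π : Equiv.Perm (Fin n)) (B : Finset (Fin n)), d = sqfree (B.map (grEmb π)) := by
  classical
  by_cases hsq : ∃ a, 2 ≤ d a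
  · obtain ⟨a, ha⟩ := hsq
    left
    refine monomial_mem_span_of_le (a := a) (b := a) (Or.inl rfl) ?_ r
    intro v
    rw [Finsupp.add_apply, Finsupp.single_apply]
    split_ifs with h
    · subst h; omega
    · simp
  push Not at hsq
  by_cases hpair : ∃ a b, a ≠ b ∧ d a ≠ 0 ∧ d b ≠ 0 ∧ (a.1 = b.1 ∨ a.2 = b.2)
  · obtain ⟨a, b, hne, ha, hb, hab⟩ := hpair
    left
    refine monomial_mem_span_of_le hab ?_ r
    intro v
    rw [Finsupp.add_apply, Finsupp.single_apply, Finsupp.single_apply]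
    by_cases h1 : a = v
    · subst h1; rw [if_pos rfl, if_neg hne.symm]; omega
    · by_cases h2 : b = v
      · subst h2; rw [if_neg h1, if_pos rfl]; omega
      · rw [if_neg h1, if_neg h2]; simp
  push Not at hpair
  right
  set T := d.support with hT
  have hdT : d = sqfree T := by
    ext v
    rw [sqfree_apply]
    split_ifs with h
    · have := hsq v; have h' := Finsupp.mem_support_iff.1 h; omega
    · simpa [hT] using h
  have hrow : ∀ a ∈ T, ∀ b ∈ T, a.1 = b.1 → a = b := by
    intro a ha b hb h
    by_contra hne
    exact (hpair a b hne (Finsupp.mem_support_iff.1 ha) (Finsupp.mem_support_iff.1 hb)).1 h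
  have hcol : ∀ a ∈ T, ∀ b ∈ T, a.2 = b.2 → a = b := by
    intro a ha b hb h
    by_contra hne
    exact (hpair a b hne (Finsupp.mem_support_iff.1 ha) (Finsupp.mem_support_iff.1 hb)).2 h
  obtain ⟨π, hπ⟩ := exists_perm_apply_snd_eq_fst T hrow hcol
  refine ⟨π, T.image Prod.snd, ?_⟩
  rw [hdT]
  congr 1
  ext v
  simp only [Finset.mem_map, Finset.mem_image, grEmb_apply]
  constructor
  · intro hv
    exact ⟨v.2, ⟨v, hv, rfl⟩, by rw [hπ v hv]⟩
  · rintro ⟨b, ⟨t, ht, rfl⟩, rfl⟩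
    rw [hπ t ht]
    exact ht

/-- `S_{n+1} = (𝒰_D)_{n+1}` (Shafiei 2015, Cor. 2.11: "every monomial of degree larger than `n`
will be unacceptable"): an acceptable monomial has at most `n` distinct columns. [cite: Shafiei2015, Corollary 2.11] -/
theorem monomial_mem_span_unacceptable_of_lt_degree {d : Fin n × Fin n →₀ ℕ} (hd : n < d.degree)
    (r : k) : monomial d r ∈ Ideal.span (unacceptableQuadrics n k) := by
  classical
  rcases monomial_mem_span_unacceptable_or_exists d r with h | ⟨π, B, rfl⟩
  · exact h
  · exfalso
    have hdeg : (sqfree (B.map (grEmb π))).degree = B.card := by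
      rw [sqfree, Finset.sum_map, map_sum]
      simp [Finsupp.degree_single]
    rw [hdeg] at hd
    exact absurd (Finset.card_le_univ B) (by simpa using hd)

/-- Homogeneous operators of degree `> n` lie in `(𝒰_D)`. [cite: Shafiei2015, Corollary 2.11] -/
theorem mem_span_unacceptable_of_isHomogeneous {D : MvPolynomial (Fin n × Fin n) k} {j : ℕ}
    (hD : D.IsHomogeneous j) (hj : n < j) : D ∈ Ideal.span (unacceptableQuadrics n k) := by
  classical
  rw [D.as_sum]
  refine Ideal.sum_mem _ fun d hd => monomial_mem_span_unacceptable_of_lt_degree ?_ _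
  have := hD (mem_support_iff.1 hd)
  have h1 : d.degree = Finsupp.weight (fun _ => 1) d := by rw [Finsupp.degree_eq_weight_one]
  rw [h1]
  convert hj
  exact this

end Trichotomy

/-! ### Separating the classes of acceptable monomials by one coefficient -/

section Coeff

variable {n : ℕ} {k : Type*} [CommRing k] (c : Equiv.Perm (Fin n) → k)

/-- The canonical derivative `canon c π₀ B` has coefficient `c π₀` at its own monomial
`x^{offGraph π₀ B}` (the tree's `coeff_canon_self`, over any commutative ring; Shafiei 2015 §2.1:
the diagonal term of a minor is its Gröbner initial term, "the initial terms give a basis").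
[cite: Shafiei2015, Section 2.1] -/
theorem coeff_sqfree_offGraph_canon_self (π₀ : Equiv.Perm (Fin n)) (B : Finset (Fin n)) :
    coeff (sqfree (offGraph π₀ B)) (canon c π₀ B) = c π₀ := by
  classical
  rw [canon, coeff_sum]
  simp only [coeff_monomial]
  rw [Finset.sum_eq_single π₀]
  · rw [if_pos rfl]
  · intro π hπ hne
    rw [if_neg]
    intro h
    exact hne (eq_of_offGraph_eq (Finset.mem_filter.1 hπ).2 (sqfree_injective h))
  · intro h
    exact (h (Finset.mem_filter.2 ⟨Finset.mem_univ _, fun b _ => rfl⟩)).elim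

/-- Graph embeddings that agree on `B` have the same image of `B`. [folklore] -/
private theorem map_grEmb_congr {π ρ : Equiv.Perm (Fin n)} {B : Finset (Fin n)} (h : ∀ b ∈ B, π b = ρ b) :
    B.map (grEmb π) = B.map (grEmb ρ) := by
  ext v
  simp only [Finset.mem_map, grEmb_apply]
  constructor
  · rintro ⟨b, hb, rfl⟩; exact ⟨b, hb, by rw [h b hb]⟩
  · rintro ⟨b, hb, rfl⟩; exact ⟨b, hb, by rw [h b hb]⟩

/-- Permutations that agree on `B` give the same row set `π(B)`. [folklore] -/
private theorem map_toEmbedding_congr {π ρ : Equiv.Perm (Fin n)} {B : Finset (Fin n)}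
    (h : ∀ b ∈ B, π b = ρ b) : B.map π.toEmbedding = B.map ρ.toEmbedding := by
  ext v
  simp only [Finset.mem_map, Equiv.toEmbedding_apply]
  constructor
  · rintro ⟨b, hb, rfl⟩; exact ⟨b, hb, by rw [h b hb]⟩
  · rintro ⟨b, hb, rfl⟩; exact ⟨b, hb, by rw [h b hb]⟩

/-- **Different classes do not interact**: the canonical derivative attached to (rows `π₁(B')`,
columns `B'`) has coefficient `0` at the own monomial of (rows `π₀(B)`, columns `B`) unless the two
(row set, column set) pairs coincide — distinct complementary minors / sub-permanents have disjoint
supports (the tree's `coeff_gen_of_ne`; Shafiei 2015 §2.1: "the `k × k` minors form a linearly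
independent set … the `k × k` permanents form another linearly independent set").
[cite: Shafiei2015, Section 2.1] -/
theorem coeff_sqfree_offGraph_canon_eq_zero {π₀ π₁ : Equiv.Perm (Fin n)} {B B' : Finset (Fin n)}
    (h : ¬ (B' = B ∧ B'.map π₁.toEmbedding = B.map π₀.toEmbedding)) :
    coeff (sqfree (offGraph π₀ B)) (canon c π₁ B') = 0 := by
  classical
  rw [canon, coeff_sum]
  refine Finset.sum_eq_zero fun π hπ => ?_
  rw [coeff_monomial, if_neg]
  intro heq
  have h' := sqfree_injective heq
  have hB : B' = B := eq_of_offGraph_eq_offGraph h'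
  subst hB
  apply h
  refine ⟨rfl, ?_⟩
  rw [← map_toEmbedding_congr (Finset.mem_filter.1 hπ).2]
  exact map_eq_map_of_offGraph_eq h'

end Coeff

/-! ### The engine: operators annihilating a permutation sum lie in the degree-two ideal -/

section Engine

variable {n : ℕ} {k : Type*} [CommRing k] (c : Equiv.Perm (Fin n) → k) (ε : k)

/-- **The degree-two ideal annihilates** (Shafiei 2015, Lemma 2.2 with Lemma 2.9 / proof of
Thm. 2.13): every element of `(𝒰_D + cross relations)` kills the permutation sum.
[cite: Shafiei2015, Lemma 2.9] -/
theorem apolarAction_permSum_eq_zero_of_mem_relIdeal (hmul : ∀ π τ, c (π * τ) = c π * c τ)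
    (hone : c 1 = 1) (hε : ∀ a b : Fin n, a ≠ b → c (Equiv.swap a b) = ε)
    {E : MvPolynomial (Fin n × Fin n) k} (hE : E ∈ relIdeal n k ε) :
    apolarAction E (permSum c) = 0 := by
  refine Submodule.span_induction (p := fun E _ => apolarAction E (permSum c) = 0) ?_ ?_ ?_ ?_ hE
  · rintro q (⟨a, b, hab, rfl⟩ | ⟨i, i', j, j', hi, hj, rfl⟩)
    · exact apolarAction_X_mul_X_permSum_eq_zero c hab
    · exact apolarAction_crossRel_permSum_eq_zero c hmul hone hε hi hj
  · exact apolarAction_zero_left _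
  · intro x y _ _ hx hy
    rw [apolarAction_add_left, hx, hy, add_zero]
  · intro a x _ hx
    rw [smul_eq_mul, apolarAction_mul, hx, apolarAction_zero_right]

/-- **The engine** (Shafiei 2015, Prop. 2.10 and Cor. 2.11, uniformly for determinant and
permanent): if `c` is multiplicative, `c(1) = 1`, and `c = ε` on transpositions, every operator
`D` with `D ∘ (∑_π c(π) ∏ᵢ a_{π i,i}) = 0` lies in the ideal generated by the unacceptable quadrics
and the cross relations `d_{ij}d_{i'j'} - ε d_{ij'}d_{i'j}`. Proof: induction on the number of
acceptable monomials in `D`; the monomials of one class (fixed row set and column set) are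
congruent modulo the ideal to multiples of one of them (`accMonomial_mul_ofSubtype_sub_smul_mem`),
and the coefficient of `D ∘ F` at the own monomial of that class shows that these multiples sum
to zero (`coeff_sqfree_offGraph_canon_self`, `coeff_sqfree_offGraph_canon_eq_zero`) — Shafiei's
binomial induction, reorganised; valid over every commutative ring. [cite: Shafiei2015, Proposition 2.10] -/
theorem mem_relIdeal_of_apolarAction_permSum_eq_zero (hmul : ∀ π τ, c (π * τ) = c π * c τ)
    (hone : c 1 = 1) (hε : ∀ a b : Fin n, a ≠ b → c (Equiv.swap a b) = ε)
    {D : MvPolynomial (Fin n × Fin n) k} (hD : apolarAction D (permSum c) = 0) :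
    D ∈ relIdeal n k ε := by
  classical
  have hIann : ∀ E ∈ relIdeal n k ε, apolarAction E (permSum c) = 0 := fun E hE =>
    apolarAction_permSum_eq_zero_of_mem_relIdeal c ε hmul hone hε hE
  have hunit : ∀ π, c π * c π⁻¹ = 1 := fun π => by rw [← hmul, mul_inv_cancel, hone]
  -- acceptability of an exponent vector
  let Acc : (Fin n × Fin n →₀ ℕ) → Prop := fun d =>
    ∃ (π : Equiv.Perm (Fin n)) (B : Finset (Fin n)), d = sqfree (B.map (grEmb π))
  suffices H : ∀ (N : ℕ) (D : MvPolynomial (Fin n × Fin n) k), (D.support.filter Acc).card = N →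
      apolarAction D (permSum c) = 0 → D ∈ relIdeal n k ε from H _ D rfl hD
  intro N
  induction N using Nat.strong_induction_on with
  | _ N ih =>
  intro D hN hD
  by_cases hempty : D.support.filter Acc = ∅
  · -- only unacceptable monomials occur
    rw [D.as_sum]
    refine Ideal.sum_mem _ fun d hd => ?_
    rcases monomial_mem_span_unacceptable_or_exists d (coeff d D) with h | h
    · exact Ideal.span_mono Set.subset_union_left h
    · exfalso
      rw [Finset.eq_empty_iff_forall_notMem] at hempty
      exact hempty d (Finset.mem_filter.2 ⟨hd, h⟩)
  obtain ⟨d₀, hd₀⟩ := Finset.nonempty_iff_ne_empty.2 hempty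
  obtain ⟨hd₀D, π₀, B, hd₀eq⟩ := Finset.mem_filter.1 hd₀
  -- the class of `d₀`: the acceptable monomials with the same row set and column set
  let Cls : (Fin n × Fin n →₀ ℕ) → Prop := fun d =>
    ∃ τ : Equiv.Perm {x // x ∈ B}, d = sqfree (B.map (grEmb (π₀ * Equiv.Perm.ofSubtype τ)))
  set T := D.support.filter Cls with hTdef
  have hTsub : T ⊆ D.support := Finset.filter_subset _ _
  have hTacc : ∀ d ∈ T, Acc d := fun d hd => by
    obtain ⟨_, τ, h⟩ := Finset.mem_filter.1 hd
    exact ⟨_, _, h⟩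
  have hd₀T : d₀ ∈ T :=
    Finset.mem_filter.2 ⟨hd₀D, 1, by rw [map_one, mul_one]; exact hd₀eq⟩
  have hτex : ∀ d ∈ T, ∃ τ : Equiv.Perm {x // x ∈ B},
      d = sqfree (B.map (grEmb (π₀ * Equiv.Perm.ofSubtype τ))) := fun d hd => (Finset.mem_filter.1 hd).2
  choose! τ hτ using hτex
  have hsupp : ∀ d i, i ∉ B → Equiv.Perm.ofSubtype (τ d) i = i := fun d i hi =>
    Equiv.Perm.ofSubtype_apply_of_not_mem _ hi
  have hmono : ∀ d ∈ T, (monomial d (coeff d D) : MvPolynomial (Fin n × Fin n) k) =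
      coeff d D • accMonomial (π₀ * Equiv.Perm.ofSubtype (τ d)) B := by
    intro d hd
    rw [accMonomial_eq_monomial, ← hτ d hd, smul_monomial, smul_eq_mul, mul_one]
  -- the coefficient of `D ∘ F` at the own monomial `m₀` of the class
  set m₀ : Fin n × Fin n →₀ ℕ := sqfree (offGraph π₀ B) with hm₀
  have hcoeffT : ∀ d ∈ T, coeff m₀ (apolarAction (monomial d (coeff d D)) (permSum c)) =
      coeff d D * c (Equiv.Perm.ofSubtype (τ d)) * c π₀ := by
    intro d hd
    rw [hmono d hd, apolarAction_smul_left, apolarAction_accMonomial_permSum,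
      canon_mul_of_support c hmul π₀ _ B (fun i hi => hsupp d i hi), coeff_smul, coeff_smul,
      coeff_sqfree_offGraph_canon_self, smul_eq_mul, smul_eq_mul, mul_assoc]
  have hcoeff0 : ∀ d ∈ D.support, d ∉ T →
      coeff m₀ (apolarAction (monomial d (coeff d D)) (permSum c)) = 0 := by
    intro d hd hdT
    rcases monomial_mem_span_unacceptable_or_exists d (coeff d D) with h | ⟨π₁, B', hdeq⟩
    · rw [hIann _ (Ideal.span_mono Set.subset_union_left h), coeff_zero]
    · have hm : (monomial d (coeff d D) : MvPolynomial (Fin n × Fin n) k) =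
          coeff d D • accMonomial π₁ B' := by
        rw [accMonomial_eq_monomial, ← hdeq, smul_monomial, smul_eq_mul, mul_one]
      rw [hm, apolarAction_smul_left, apolarAction_accMonomial_permSum, coeff_smul,
        coeff_sqfree_offGraph_canon_eq_zero c, smul_zero]
      rintro ⟨hBB, hmap⟩
      rw [hBB] at hdeq hmap
      apply hdT
      refine Finset.mem_filter.2 ⟨hd, ?_⟩
      have hperm : ∀ x, (π₀⁻¹ * π₁) x ∈ B ↔ x ∈ B := by
        intro x
        rw [Equiv.Perm.coe_mul, Function.comp_apply, Equiv.Perm.coe_inv, ← Finset.mem_map_equiv,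
          ← hmap, Finset.mem_map_equiv, Equiv.symm_apply_apply]
      refine ⟨(π₀⁻¹ * π₁).subtypePerm hperm, ?_⟩
      rw [hdeq]
      congr 1
      apply map_grEmb_congr
      intro b hb
      change π₁ b = π₀ (Equiv.Perm.ofSubtype _ b)
      rw [Equiv.Perm.ofSubtype_apply_of_mem _ hb, Equiv.Perm.subtypePerm_apply]
      change π₁ b = π₀ ((π₀⁻¹ * π₁) b)
      simp
  have hsum0 : (∑ d ∈ T, coeff d D * c (Equiv.Perm.ofSubtype (τ d))) = 0 := by
    have h0 : coeff m₀ (apolarAction (∑ d ∈ D.support, monomial d (coeff d D)) (permSum c)) = 0 := by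
      rw [← D.as_sum, hD, coeff_zero]
    rw [apolarAction_sum_left, coeff_sum, ← Finset.sum_filter_add_sum_filter_not D.support Cls,
      Finset.sum_eq_zero (s := D.support.filter fun d => ¬ Cls d), add_zero, ← hTdef,
      Finset.sum_congr rfl hcoeffT, ← Finset.sum_mul] at h0
    · calc (∑ d ∈ T, coeff d D * c (Equiv.Perm.ofSubtype (τ d)))
          = (∑ d ∈ T, coeff d D * c (Equiv.Perm.ofSubtype (τ d))) * (c π₀ * c π₀⁻¹) := by
            rw [hunit, mul_one]
        _ = 0 := by rw [← mul_assoc, h0, zero_mul]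
    · intro d hd
      obtain ⟨hdD, hdC⟩ := Finset.mem_filter.1 hd
      exact hcoeff0 d hdD (fun hdT => hdC (Finset.mem_filter.1 hdT).2)
  -- the class sum lies in the ideal
  set E : MvPolynomial (Fin n × Fin n) k := ∑ d ∈ T, monomial d (coeff d D) with hE
  have hEmem : E ∈ relIdeal n k ε := by
    have hEeq : E = ∑ d ∈ T, coeff d D • (accMonomial (π₀ * Equiv.Perm.ofSubtype (τ d)) B -
        c (Equiv.Perm.ofSubtype (τ d)) • (accMonomial π₀ B : MvPolynomial (Fin n × Fin n) k)) +
        (∑ d ∈ T, coeff d D * c (Equiv.Perm.ofSubtype (τ d))) • (accMonomial π₀ B) := by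
      rw [hE, Finset.sum_smul, ← Finset.sum_add_distrib]
      refine Finset.sum_congr rfl fun d hd => ?_
      rw [hmono d hd, smul_sub, smul_smul, sub_add_cancel]
    rw [hEeq, hsum0, zero_smul, add_zero]
    exact Ideal.sum_mem _ fun d _ => smul_mem_ideal _ _
      (accMonomial_mul_ofSubtype_sub_smul_mem c ε hmul hone hε B (τ d) π₀)
  -- remove the class and recurse
  set D₁ : MvPolynomial (Fin n × Fin n) k := D - E with hD₁
  have hcoeffD₁ : ∀ e, coeff e D₁ = if e ∈ T then 0 else coeff e D := by
    intro e
    rw [hD₁, coeff_sub, hE, coeff_sum]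
    simp only [coeff_monomial]
    rw [Finset.sum_ite_eq' T e]
    split_ifs with h
    · rw [sub_self]
    · rw [sub_zero]
  have hsuppD₁ : D₁.support = D.support \ T := by
    ext e
    rw [mem_support_iff, hcoeffD₁, Finset.mem_sdiff, mem_support_iff]
    split_ifs with h
    · simp [h]
    · simp [h]
  have hcard : (D₁.support.filter Acc).card < N := by
    rw [← hN, hsuppD₁]
    refine Finset.card_lt_card ⟨fun d hd => ?_, fun hsub => ?_⟩
    · obtain ⟨hd, hacc⟩ := Finset.mem_filter.1 hd
      exact Finset.mem_filter.2 ⟨(Finset.mem_sdiff.1 hd).1, hacc⟩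
    · have := hsub hd₀
      rw [Finset.mem_filter, Finset.mem_sdiff] at this
      exact this.1.2 hd₀T
  have hD₁ann : apolarAction D₁ (permSum c) = 0 := by
    rw [hD₁, apolarAction_sub_left, hD, hIann E hEmem, sub_zero]
  have h1 := ih _ hcard D₁ rfl hD₁ann
  rw [show D = D₁ + E by rw [hD₁, sub_add_cancel]]
  exact Ideal.add_mem _ h1 hEmem

/-- **The engine as an equality of ideals**: `Ann(∑_π c(π) ∏ᵢ a_{π i,i}) = (𝒰_D + cross relations)`
under the hypotheses of `mem_relIdeal_of_apolarAction_permSum_eq_zero`. [cite: Shafiei2015, Theorem 2.12] -/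
theorem annihilatorIdeal_permSum_eq_relIdeal (hmul : ∀ π τ, c (π * τ) = c π * c τ)
    (hone : c 1 = 1) (hε : ∀ a b : Fin n, a ≠ b → c (Equiv.swap a b) = ε) :
    annihilatorIdeal (permSum c) = relIdeal n k ε := by
  apply le_antisymm
  · intro D hD
    exact mem_relIdeal_of_apolarAction_permSum_eq_zero c ε hmul hone hε hD
  · intro E hE
    exact apolarAction_permSum_eq_zero_of_mem_relIdeal c ε hmul hone hε hE

end Engine

/-! ### No relations below degree two -/

section LowDegree

variable {n : ℕ} {k : Type*} [CommRing k] (ε : k)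

/-- The generators are homogeneous quadrics: every unacceptable quadric and every cross relation is
homogeneous of degree `2` ("generated in degree two"). [cite: Shafiei2015, Theorem 2.12] -/
theorem isHomogeneous_two_of_mem_generators {q : MvPolynomial (Fin n × Fin n) k}
    (hq : q ∈ unacceptableQuadrics n k ∪ crossRel n k ε) : q.IsHomogeneous 2 := by
  rcases hq with ⟨a, b, -, rfl⟩ | ⟨i, i', j, j', -, -, rfl⟩
  · exact (isHomogeneous_X k a).mul (isHomogeneous_X k b)
  · have h2 : ∀ a b : Fin n × Fin n, (X a * X b : MvPolynomial (Fin n × Fin n) k).IsHomogeneous 2 :=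
      fun a b => (isHomogeneous_X k a).mul (isHomogeneous_X k b)
    rw [smul_eq_C_mul]
    have h3 : (C ε * (X (i, j') * X (i', j)) : MvPolynomial (Fin n × Fin n) k).IsHomogeneous 2 := by
      simpa using (isHomogeneous_C (Fin n × Fin n) ε).mul (h2 (i, j') (i', j))
    exact (h2 _ _).sub h3

/-- Elements of the ideal generated by the (degree-two) unacceptable quadrics and cross relations
have no terms of degree `< 2` ("generated in degree two"). [cite: Shafiei2015, Theorem 2.12] -/
theorem coeff_eq_zero_of_mem_relIdeal {D : MvPolynomial (Fin n × Fin n) k} (hD : D ∈ relIdeal n k ε)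
    {d : Fin n × Fin n →₀ ℕ} (hd : d.degree < 2) : coeff d D = 0 := by
  classical
  suffices H : ∀ e : Fin n × Fin n →₀ ℕ, e.degree < 2 → coeff e D = 0 from H d hd
  refine Submodule.span_induction (p := fun D _ => ∀ e : Fin n × Fin n →₀ ℕ, e.degree < 2 → coeff e D = 0)
    ?_ ?_ ?_ ?_ hD
  · intro q hq e he
    have hq2 := isHomogeneous_two_of_mem_generators ε hq
    by_contra hne
    have := hq2 hne
    have h1 : e.degree = 2 := by rw [Finsupp.degree_eq_weight_one]; exact this
    omega
  · intro d _; exact coeff_zero d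
  · intro x y _ _ hx hy d hd
    rw [coeff_add, hx d hd, hy d hd, add_zero]
  · intro r x _ hx d hd
    rw [smul_eq_mul, coeff_mul]
    refine Finset.sum_eq_zero fun uv huv => ?_
    have hv : uv.2.degree ≤ d.degree := by
      rw [Finset.mem_antidiagonal] at huv
      rw [← huv, map_add]
      exact Nat.le_add_left _ _
    rw [hx uv.2 (lt_of_le_of_lt hv hd), mul_zero]

end LowDegree

/-! ### Shafiei's theorems for the generic determinant and permanent -/

section Main

variable (n : ℕ) (k : Type*) [CommRing k]

/-- The sign character is multiplicative, `1` at the identity and `-1` on transpositions (cast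
into `k`). [folklore] -/
private theorem sign_cast_props :
    (∀ π τ : Equiv.Perm (Fin n), (((Equiv.Perm.sign (π * τ) : ℤˣ) : ℤ) : k) =
        (((Equiv.Perm.sign π : ℤˣ) : ℤ) : k) * (((Equiv.Perm.sign τ : ℤˣ) : ℤ) : k)) ∧
      (((Equiv.Perm.sign (1 : Equiv.Perm (Fin n)) : ℤˣ) : ℤ) : k) = 1 ∧
      ∀ a b : Fin n, a ≠ b → (((Equiv.Perm.sign (Equiv.swap a b) : ℤˣ) : ℤ) : k) = -1 := by
  refine ⟨fun π τ => ?_, ?_, fun a b hab => ?_⟩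
  · rw [Equiv.Perm.sign_mul, Units.val_mul, Int.cast_mul]
  · rw [Equiv.Perm.sign_one, Units.val_one, Int.cast_one]
  · rw [Equiv.Perm.sign_swap hab, Units.val_neg, Units.val_one, Int.cast_neg, Int.cast_one]

/-- **Shafiei 2015, Theorem 2.12 (apolar ideal of the generic determinant).** "Let `A` be a
generic `n × n` matrix. Then the apolar ideal `Ann(det(A)) ⊂ S` is the ideal `(𝒫_D + 𝒰_D)`, and
is generated in degree two": the operators `Φ ∈ k[d_{ij}]` with `Φ ∘ det(A) = 0` form the ideal
generated by the unacceptable quadrics (products of two entries of one row or one column of `D`,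
squares included) and the `2 × 2` permanents of `D`. Printed over a field of characteristic `0`
or `> 2` with the contraction action; here over every commutative ring `k` with the tree's
differentiation action `apolarAction` (the two actions agree on the multilinear `det`/`perm`).
Proof = the engine `annihilatorIdeal_permSum_eq_relIdeal` at `c = sgn`, `ε = -1` (Prop. 2.10 /
Cor. 2.11 reorganised, see there). [cite: Shafiei2015, Theorem 2.12] -/
theorem annihilatorIdeal_detPoly :
    annihilatorIdeal (detPoly (Fin n) k) = Ideal.span (unacceptableQuadrics n k ∪ twoByTwoPerms n k) := by
  obtain ⟨hmul, hone, hε⟩ := sign_cast_props n k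
  rw [detPoly_eq_permSum, annihilatorIdeal_permSum_eq_relIdeal _ (-1) hmul hone hε, relIdeal,
    crossRel_neg_one]

/-- **Shafiei 2015, Theorem 2.13 (apolar ideal of the generic permanent).** "Let `A` be a generic
`n × n` matrix. Then the apolar ideal `Ann(Per(A)) ⊂ S` … is the ideal `(ℳ_D + 𝒰_D)`, generated in
degree two": generated by the unacceptable quadrics and the `2 × 2` minors of `D`. Every
commutative ring `k` (engine at `c = 1`, `ε = 1`). [cite: Shafiei2015, Theorem 2.13] -/
theorem annihilatorIdeal_perPoly :
    annihilatorIdeal (perPoly (Fin n) k) = Ideal.span (unacceptableQuadrics n k ∪ twoByTwoMinors n k) := by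
  rw [perPoly_eq_permSum, annihilatorIdeal_permSum_eq_relIdeal (fun _ => (1 : k)) 1 (fun _ _ => (mul_one _).symm)
    rfl (fun _ _ _ => rfl), relIdeal, crossRel_one]

/-- Theorem 2.12 on the tree's set `annihilator`: `det(A)^{ann} = (𝒫_D + 𝒰_D)` as sets.
[cite: Shafiei2015, Theorem 2.12] -/
theorem annihilator_detPoly :
    annihilator (detPoly (Fin n) k) =
      (Ideal.span (unacceptableQuadrics n k ∪ twoByTwoPerms n k) : Set (MvPolynomial (Fin n × Fin n) k)) := by
  rw [← coe_annihilatorIdeal, annihilatorIdeal_detPoly]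

/-- Theorem 2.13 on the tree's set `annihilator`: `Per(A)^{ann} = (ℳ_D + 𝒰_D)` as sets.
[cite: Shafiei2015, Theorem 2.13] -/
theorem annihilator_perPoly :
    annihilator (perPoly (Fin n) k) =
      (Ideal.span (unacceptableQuadrics n k ∪ twoByTwoMinors n k) : Set (MvPolynomial (Fin n × Fin n) k)) := by
  rw [← coe_annihilatorIdeal, annihilatorIdeal_perPoly]

/-- **Shafiei 2015, Corollary 2.11 (degree pieces, determinant).** "For a generic `n × n` matrix `A`
and each integer `k`, `1 ≤ k ≤ n`, we have `(𝒫_D + 𝒰_D)_k = Ann(det(A)) ∩ S_k`": the degree-`j`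
annihilator `Ann_j(det_n)` is the degree-`j` part of the ideal `(𝒫_D + 𝒰_D)` (here for every `j`).
[cite: Shafiei2015, Corollary 2.11] -/
theorem annihilatorOfDegree_detPoly (j : ℕ) :
    annihilatorOfDegree (detPoly (Fin n) k) j =
      {D | D.IsHomogeneous j ∧ D ∈ Ideal.span (unacceptableQuadrics n k ∪ twoByTwoPerms n k)} := by
  rw [annihilatorOfDegree_eq_sep, annihilatorIdeal_detPoly]

/-- Corollary 2.11 for the permanent (proof of Thm. 2.13): `Ann_j(perm_n)` is the degree-`j` part of
`(ℳ_D + 𝒰_D)`. [cite: Shafiei2015, Corollary 2.11] -/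
theorem annihilatorOfDegree_perPoly (j : ℕ) :
    annihilatorOfDegree (perPoly (Fin n) k) j =
      {D | D.IsHomogeneous j ∧ D ∈ Ideal.span (unacceptableQuadrics n k ∪ twoByTwoMinors n k)} := by
  rw [annihilatorOfDegree_eq_sep, annihilatorIdeal_perPoly]

/-- **Corollary 2.11, second clause**: "`(𝒰_D)_{n+1} = S_{n+1}`" — in degrees `j > n` the apolar
ideal of `det_n` is all of `S_j`, indeed already `(𝒰_D)_j = S_j`: every operator of degree `> n`
annihilates `det_n` and lies in the ideal of unacceptable quadrics. [cite: Shafiei2015, Corollary 2.11] -/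
theorem annihilatorOfDegree_detPoly_of_lt {j : ℕ} (hj : n < j) :
    annihilatorOfDegree (detPoly (Fin n) k) j = {D | D.IsHomogeneous j} := by
  rw [annihilatorOfDegree_detPoly]
  ext D
  simp only [Set.mem_setOf_eq, and_iff_left_iff_imp]
  intro hD
  exact Ideal.span_mono Set.subset_union_left (mem_span_unacceptable_of_isHomogeneous hD hj)

/-- The same for the permanent: `Ann_j(perm_n) = S_j` for `j > n`. [cite: Shafiei2015, Corollary 2.11] -/
theorem annihilatorOfDegree_perPoly_of_lt {j : ℕ} (hj : n < j) :
    annihilatorOfDegree (perPoly (Fin n) k) j = {D | D.IsHomogeneous j} := by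
  rw [annihilatorOfDegree_perPoly]
  ext D
  simp only [Set.mem_setOf_eq, and_iff_left_iff_imp]
  intro hD
  exact Ideal.span_mono Set.subset_union_left (mem_span_unacceptable_of_isHomogeneous hD hj)

/-- **No linear or constant annihilators** (the Hilbert function starts `1, n², …`; Shafiei 2015
eq. (2.1) at `k = 0, 1`: `H(S/Ann(det A))_0 = 1`, `H_1 = n²`): an operator of degree `≤ 1`
annihilating `det_n` is `0` — the ideal is generated by quadrics. [cite: Shafiei2015, Section 2.1] -/
theorem eq_zero_of_mem_annihilatorOfDegree_detPoly_of_le_one {j : ℕ} (hj : j ≤ 1)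
    {D : MvPolynomial (Fin n × Fin n) k} (hD : D ∈ annihilatorOfDegree (detPoly (Fin n) k) j) : D = 0 := by
  classical
  rw [annihilatorOfDegree_detPoly, ← crossRel_neg_one] at hD
  obtain ⟨hhom, hmem⟩ := hD
  ext d
  rw [coeff_zero]
  by_cases hd : d.degree < 2
  · exact coeff_eq_zero_of_mem_relIdeal (-1) hmem hd
  · by_contra hne
    have := hhom hne
    have h1 : d.degree = j := by rw [Finsupp.degree_eq_weight_one]; exact this
    omega

/-- The same for the permanent: `Ann_j(perm_n) = 0` for `j ≤ 1`. [cite: Shafiei2015, Section 2.1] -/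
theorem eq_zero_of_mem_annihilatorOfDegree_perPoly_of_le_one {j : ℕ} (hj : j ≤ 1)
    {D : MvPolynomial (Fin n × Fin n) k} (hD : D ∈ annihilatorOfDegree (perPoly (Fin n) k) j) : D = 0 := by
  classical
  rw [annihilatorOfDegree_perPoly, ← crossRel_one] at hD
  obtain ⟨hhom, hmem⟩ := hD
  ext d
  rw [coeff_zero]
  by_cases hd : d.degree < 2
  · exact coeff_eq_zero_of_mem_relIdeal 1 hmem hd
  · by_contra hne
    have := hhom hne
    have h1 : d.degree = j := by rw [Finsupp.degree_eq_weight_one]; exact this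
    omega

/-- **Lemma 2.2** as printed: each `2 × 2` permanent of `D` annihilates `det(A)`.
[cite: Shafiei2015, Lemma 2.2] -/
theorem apolarAction_twoByTwoPerm_detPoly {q : MvPolynomial (Fin n × Fin n) k}
    (hq : q ∈ twoByTwoPerms n k) : apolarAction q (detPoly (Fin n) k) = 0 := by
  have h : q ∈ annihilatorIdeal (detPoly (Fin n) k) := by
    rw [annihilatorIdeal_detPoly]
    exact Ideal.subset_span (Or.inr hq)
  exact h

/-- The `2 × 2` minors of `D` annihilate `Per(A)` (proof of Thm. 2.13). [cite: Shafiei2015, Theorem 2.13] -/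
theorem apolarAction_twoByTwoMinor_perPoly {q : MvPolynomial (Fin n × Fin n) k}
    (hq : q ∈ twoByTwoMinors n k) : apolarAction q (perPoly (Fin n) k) = 0 := by
  have h : q ∈ annihilatorIdeal (perPoly (Fin n) k) := by
    rw [annihilatorIdeal_perPoly]
    exact Ideal.subset_span (Or.inr hq)
  exact h

/-- The unacceptable quadrics annihilate both `det(A)` and `Per(A)`. [cite: Shafiei2015, Definition 2.5] -/
theorem apolarAction_unacceptable_detPoly_perPoly {q : MvPolynomial (Fin n × Fin n) k}
    (hq : q ∈ unacceptableQuadrics n k) :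
    apolarAction q (detPoly (Fin n) k) = 0 ∧ apolarAction q (perPoly (Fin n) k) = 0 := by
  constructor
  · have h : q ∈ annihilatorIdeal (detPoly (Fin n) k) := by
      rw [annihilatorIdeal_detPoly]; exact Ideal.subset_span (Or.inl hq)
    exact h
  · have h : q ∈ annihilatorIdeal (perPoly (Fin n) k) := by
      rw [annihilatorIdeal_perPoly]; exact Ideal.subset_span (Or.inl hq)
    exact h

end Main

/-! ### The apolar (catalecticant) map, Lemma 1.3 and the Hilbert function (2.1) -/

section Hilbert

variable {σ : Type*} {k : Type*} [CommRing k]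

/-- The **apolar map** `Φ ↦ Φ ∘ F` of a fixed form `F` (Shafiei 2015, Remark 1.2: the pairing
`φ(g, f) = g ∘ f`; for `Φ ∈ S_s` this is the flattening `F_{s,d-s}`, Notation (LT) in §3), as a
`k`-linear map on the operator ring. [cite: Shafiei2015, Remark 1.2] -/
def apolarMap (f : MvPolynomial σ k) : MvPolynomial σ k →ₗ[k] MvPolynomial σ k where
  toFun D := apolarAction D f
  map_add' D E := apolarAction_add_left D E f
  map_smul' a D := apolarAction_smul_left a D f

/-- Unfolding `apolarMap`. [cite: Shafiei2015, Remark 1.2] -/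
@[simp] theorem apolarMap_apply (f D : MvPolynomial σ k) : apolarMap f D = apolarAction D f := rfl

/-- The kernel of the apolar map is the apolar ideal (as a `k`-submodule). [cite: Shafiei2015, Definition 1.1] -/
theorem ker_apolarMap (f : MvPolynomial σ k) :
    LinearMap.ker (apolarMap f) = (annihilatorIdeal f).restrictScalars k := by
  ext D
  rw [LinearMap.mem_ker, apolarMap_apply, Submodule.restrictScalars_mem, mem_annihilatorIdeal_iff]

/-- A product of variables is a form of degree the number of factors. [folklore] -/
private theorem isHomogeneous_listProd_X (l : List σ) :
    ((l.map X).prod : MvPolynomial σ k).IsHomogeneous l.length := by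
  induction l with
  | nil => rw [List.map_nil, List.prod_nil, List.length_nil]; exact isHomogeneous_one σ k
  | cons a l ih =>
    rw [List.map_cons, List.prod_cons, List.length_cons, add_comm]
    exact (isHomogeneous_X k a).mul ih

/-- Every monomial is a product of variables, listed with multiplicity. [folklore] -/
private theorem exists_list_prod_X_eq_monomial [DecidableEq σ] (d : σ →₀ ℕ) :
    ∃ l : List σ, l.length = d.degree ∧ ((l.map X).prod : MvPolynomial σ k) = monomial d 1 := by
  induction d using Finsupp.induction with
  | zero => exact ⟨[], by simp, by simp⟩
  | single_add a m f _ _ ih =>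
    obtain ⟨l, hl, hprod⟩ := ih
    refine ⟨List.replicate m a ++ l, ?_, ?_⟩
    · rw [List.length_append, List.length_replicate, hl, map_add, Finsupp.degree_single]
    · rw [List.map_append, List.prod_append, hprod, List.map_replicate, List.prod_replicate,
        X_pow_eq_monomial, monomial_mul, one_mul]

/-- **Shafiei 2015, Lemma 1.3 (bridge)**: "`S_k ∘ det(A) = M_{n-k}(A) ⊂ R_{n-k}`" — the image of the
degree-`j` operators under the apolar map is the span of the `j`-th order partial derivatives
(the tree's `derivSet j f`, whose span for `det_n`/`perm_n` is the span of the canonical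
derivatives = complementary minors / sub-permanents, `span_derivSet_permSum`). Any form `f`,
any commutative ring. [cite: Shafiei2015, Lemma 1.3] -/
theorem map_apolarMap_homogeneousSubmodule (f : MvPolynomial σ k) (j : ℕ) :
    (homogeneousSubmodule σ k j).map (apolarMap f) = Submodule.span k (derivSet j f) := by
  classical
  apply le_antisymm
  · rw [Submodule.map_le_iff_le_comap]
    intro D hD
    rw [mem_homogeneousSubmodule] at hD
    rw [Submodule.mem_comap, apolarMap_apply, D.as_sum, apolarAction_sum_left]
    refine Submodule.sum_mem _ fun d hd => ?_
    obtain ⟨l, hl, hprod⟩ := exists_list_prod_X_eq_monomial (k := k) d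
    have hmono : (monomial d (coeff d D) : MvPolynomial σ k) = coeff d D • (l.map X).prod := by
      rw [hprod, smul_monomial, smul_eq_mul, mul_one]
    rw [hmono, apolarAction_smul_left, apolarAction_listProd_X]
    refine Submodule.smul_mem _ _ (Submodule.subset_span ⟨l, ?_, rfl⟩)
    rw [hl]
    have := hD (mem_support_iff.1 hd)
    rw [Finsupp.degree_eq_weight_one]
    exact this
  · rw [Submodule.span_le]
    rintro g ⟨l, hl, rfl⟩
    refine ⟨(l.map X).prod, ?_, ?_⟩
    · rw [SetLike.mem_coe, mem_homogeneousSubmodule, ← hl]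
      exact isHomogeneous_listProd_X l
    · rw [apolarMap_apply, apolarAction_listProd_X]

variable (K : Type*) [Field K] (n : ℕ)

/-- **Shafiei 2015, §2.1 / Lemma 1.3 for the determinant**: `dim_K (S_j ∘ det(A)) = binom(n,j)²`
("the dimension of the space of `k × k` minors of an `n × n` matrix … [is] `binom(n,k)²`") — via
the tree's flattening rank `flatteningRank_detPoly`. [cite: Shafiei2015, Section 2.1] -/
theorem finrank_map_apolarMap_detPoly (j : ℕ) :
    Module.finrank K ((homogeneousSubmodule (Fin n × Fin n) K j).map (apolarMap (detPoly (Fin n) K))) =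
      (n.choose j) ^ 2 := by
  rw [map_apolarMap_homogeneousSubmodule, ← shiftedPartialsRank_zero_eq, flatteningRank_detPoly]

/-- The same count for the permanent: `dim_K (S_j ∘ Per(A)) = binom(n,j)²` (sub-permanents).
[cite: Shafiei2015, Section 2.1] -/
theorem finrank_map_apolarMap_perPoly (j : ℕ) :
    Module.finrank K ((homogeneousSubmodule (Fin n × Fin n) K j).map (apolarMap (perPoly (Fin n) K))) =
      (n.choose j) ^ 2 := by
  rw [map_apolarMap_homogeneousSubmodule, ← shiftedPartialsRank_zero_eq, flatteningRank_perPoly]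

/-- `Ann(F)_j` as the tree's degree piece `idealDegree (annihilatorIdeal F) j` (a `K`-subspace of
`S_j`) has carrier `annihilatorOfDegree F j`. [cite: Shafiei2015, Definition 1.1] -/
theorem mem_idealDegree_annihilatorIdeal_iff {τ : Type*} (f D : MvPolynomial τ K) (j : ℕ) :
    D ∈ Literature.RingTheory.MvPolynomial.idealDegree (annihilatorIdeal f) j ↔
      D ∈ annihilatorOfDegree f j := by
  rw [Literature.RingTheory.MvPolynomial.mem_idealDegree, mem_annihilatorOfDegree_iff,
    mem_annihilatorIdeal_iff, and_comm]

/-- **Rank–nullity for the apolar map on `S_j`** (Shafiei 2015, Remark 1.2, eq. (1.2):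
"`dim_k(V^⊥) = dim_k S_k - dim_k V`"): `dim S_j = dim Ann(F)_j + dim (S_j ∘ F)`, finitely many
variables, any form `F`. [cite: Shafiei2015, Remark 1.2] -/
theorem finrank_homogeneousSubmodule_eq_finrank_ann_add {τ : Type*} [Finite τ]
    (f : MvPolynomial τ K) (j : ℕ) :
    Module.finrank K (homogeneousSubmodule τ K j) =
      Module.finrank K (Literature.RingTheory.MvPolynomial.idealDegree (annihilatorIdeal f) j) +
        Module.finrank K ((homogeneousSubmodule τ K j).map (apolarMap f)) := by
  haveI : Module.Finite K (homogeneousSubmodule τ K j) :=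
    Module.Finite.iff_fg.mpr (homogeneousSubmodule_fg τ K j)
  have h := LinearMap.finrank_range_add_finrank_ker ((apolarMap f).domRestrict (homogeneousSubmodule τ K j))
  rw [LinearMap.range_domRestrict, LinearMap.ker_domRestrict] at h
  have hker : Module.finrank K ((LinearMap.ker (apolarMap f)).comap (homogeneousSubmodule τ K j).subtype) =
      Module.finrank K (Literature.RingTheory.MvPolynomial.idealDegree (annihilatorIdeal f) j) := by
    rw [← Submodule.finrank_map_subtype_eq, Submodule.map_comap_subtype, ker_apolarMap,
      Literature.RingTheory.MvPolynomial.idealDegree, inf_comm]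
  rw [← h, hker, add_comm]

/-- **Shafiei 2015, eq. (2.1) (Hilbert function of the apolar algebra of the determinant)**:
"`H(S/Ann(det A))_k = H(S/Ann(Perm A))_k = binom(n,k)²`" — in the tree's convention
`H(I; t) = dim S_t - dim I_t` (`HomogeneousHilbertFunction.lean`). [cite: Shafiei2015, Equation (2.1)] -/
theorem hilbertFunction_annihilatorIdeal_detPoly (j : ℕ) :
    Module.finrank K (homogeneousSubmodule (Fin n × Fin n) K j) -
        Module.finrank K (Literature.RingTheory.MvPolynomial.idealDegree
          (annihilatorIdeal (detPoly (Fin n) K)) j) = (n.choose j) ^ 2 := by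
  rw [finrank_homogeneousSubmodule_eq_finrank_ann_add, finrank_map_apolarMap_detPoly, Nat.add_sub_cancel_left]

/-- Eq. (2.1) for the permanent: `H(S/Ann(Perm A))_j = binom(n,j)²`. [cite: Shafiei2015, Equation (2.1)] -/
theorem hilbertFunction_annihilatorIdeal_perPoly (j : ℕ) :
    Module.finrank K (homogeneousSubmodule (Fin n × Fin n) K j) -
        Module.finrank K (Literature.RingTheory.MvPolynomial.idealDegree
          (annihilatorIdeal (perPoly (Fin n) K)) j) = (n.choose j) ^ 2 := by
  rw [finrank_homogeneousSubmodule_eq_finrank_ann_add, finrank_map_apolarMap_perPoly, Nat.add_sub_cancel_left]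

/-- **Shafiei 2015, eq. (2.2) (length of the apolar algebra)**: "`dim_k 𝔄_A = ∑_{k=0}^{n} binom(n,k)²
= binom(2n,n)`" — the Hilbert function of `S/Ann(det A)` summed over the degrees `0, …, n` (it
vanishes above `n`, `annihilatorOfDegree_detPoly_of_lt`). [cite: Shafiei2015, Equation (2.2)] -/
theorem sum_hilbertFunction_annihilatorIdeal_detPoly :
    ∑ j ∈ Finset.range (n + 1), (Module.finrank K (homogeneousSubmodule (Fin n × Fin n) K j) -
        Module.finrank K (Literature.RingTheory.MvPolynomial.idealDegree
          (annihilatorIdeal (detPoly (Fin n) K)) j)) = (2 * n).choose n := by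
  rw [← Nat.sum_range_choose_sq]
  exact Finset.sum_congr rfl fun j _ => hilbertFunction_annihilatorIdeal_detPoly K n j

/-- Eq. (2.2) for the permanent: the apolar algebra of `Per(A)` also has length `binom(2n,n)`.
[cite: Shafiei2015, Equation (2.2)] -/
theorem sum_hilbertFunction_annihilatorIdeal_perPoly :
    ∑ j ∈ Finset.range (n + 1), (Module.finrank K (homogeneousSubmodule (Fin n × Fin n) K j) -
        Module.finrank K (Literature.RingTheory.MvPolynomial.idealDegree
          (annihilatorIdeal (perPoly (Fin n) K)) j)) = (2 * n).choose n := by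
  rw [← Nat.sum_range_choose_sq]
  exact Finset.sum_congr rfl fun j _ => hilbertFunction_annihilatorIdeal_perPoly K n j

/-- In degrees `j > n` the Hilbert function of `S/Ann(det A)` vanishes: `Ann(det A)_j = S_j`
(Cor. 2.11, `(𝒰_D)_{n+1} = S_{n+1}`). [cite: Shafiei2015, Corollary 2.11] -/
theorem hilbertFunction_annihilatorIdeal_detPoly_of_lt {j : ℕ} (hj : n < j) :
    Module.finrank K (homogeneousSubmodule (Fin n × Fin n) K j) -
        Module.finrank K (Literature.RingTheory.MvPolynomial.idealDegree
          (annihilatorIdeal (detPoly (Fin n) K)) j) = 0 := by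
  rw [hilbertFunction_annihilatorIdeal_detPoly, Nat.choose_eq_zero_of_lt hj, zero_pow two_ne_zero]

end Hilbert

/-! ### The apolar ideal is homogeneous; the degree-two piece as a vector space (Lemma 2.7) -/

section Homogeneous

variable {σ : Type*} {k : Type*} [CommRing k]

/-- An operator of higher degree than the form it acts on acts by zero. [folklore] -/
private theorem apolarAction_eq_zero_of_degree_lt {D f : MvPolynomial σ k} {i m : ℕ}
    (hD : D.IsHomogeneous i) (hf : f.IsHomogeneous m) (h : m < i) : apolarAction D f = 0 := by
  classical
  rw [apolarAction_def]
  refine Finset.sum_eq_zero fun e he => Finset.sum_eq_zero fun d hd => ?_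
  have h1 : e.degree = i := by rw [Finsupp.degree_eq_weight_one]; exact hD (mem_support_iff.1 he)
  have h2 : d.degree = m := by rw [Finsupp.degree_eq_weight_one]; exact hf (mem_support_iff.1 hd)
  have hed : ¬ e ≤ d := by
    intro hle
    have := Finsupp.degree_mono hle
    omega
  obtain ⟨x, hx⟩ : ∃ x, d x < e x := by
    by_contra hcon
    push Not at hcon
    exact hed fun x => hcon x
  have hxe : x ∈ e.support := Finsupp.mem_support_iff.2 (by omega)
  rw [Finset.prod_eq_zero hxe (by rw [Nat.descFactorial_eq_zero_iff_lt.2 hx, Nat.cast_zero]),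
    mul_zero, monomial_zero]

/-- **`Ann(F)` is a homogeneous ideal** for a form `F` (Shafiei 2015, Def. 1.1: "`(Ann(F))_k =
{h ∈ S_k | h ∘ F = 0}`", i.e. `Ann(F) = ⊕_k Ann(F)_k`): every homogeneous component of an
annihilating operator annihilates. Any commutative ring. [cite: Shafiei2015, Definition 1.1] -/
theorem homogeneousComponent_mem_annihilatorIdeal {f D : MvPolynomial σ k} {m : ℕ}
    (hf : f.IsHomogeneous m) (hD : D ∈ annihilatorIdeal f) (j : ℕ) :
    homogeneousComponent j D ∈ annihilatorIdeal f := by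
  classical
  rw [mem_annihilatorIdeal_iff] at hD ⊢
  rcases lt_or_ge m j with hj | hj
  · exact apolarAction_eq_zero_of_degree_lt (homogeneousComponent_isHomogeneous j D) hf hj
  by_cases hrange : j ∈ Finset.range (D.totalDegree + 1)
  swap
  · rw [homogeneousComponent_eq_zero, apolarAction_zero_left]
    rw [Finset.mem_range, not_lt] at hrange
    omega
  have key : homogeneousComponent (m - j) (apolarAction D f) = apolarAction (homogeneousComponent j D) f := by
    conv_lhs => rw [← sum_homogeneousComponent D, apolarAction_sum_left]
    rw [map_sum, Finset.sum_eq_single j]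
    · rw [homogeneousComponent_of_mem ((mem_homogeneousSubmodule _ _).2
        (apolarAction_isHomogeneous (homogeneousComponent_isHomogeneous j D) hf)), if_pos rfl]
    · intro i _ hij
      rcases lt_or_ge m i with hmi | hmi
      · rw [apolarAction_eq_zero_of_degree_lt (homogeneousComponent_isHomogeneous i D) hf hmi, map_zero]
      · rw [homogeneousComponent_of_mem ((mem_homogeneousSubmodule _ _).2
          (apolarAction_isHomogeneous (homogeneousComponent_isHomogeneous i D) hf)), if_neg]
        omega
    · intro h
      exact absurd hrange h
  rw [← key, hD, map_zero]

/-- For the determinant: the homogeneous components of an annihilating operator annihilate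
`det_n`. [cite: Shafiei2015, Definition 1.1] -/
theorem homogeneousComponent_mem_annihilatorIdeal_detPoly {n : ℕ}
    {D : MvPolynomial (Fin n × Fin n) k} (hD : D ∈ annihilatorIdeal (detPoly (Fin n) k)) (j : ℕ) :
    homogeneousComponent j D ∈ annihilatorIdeal (detPoly (Fin n) k) := by
  have hf : (detPoly (Fin n) k).IsHomogeneous n := by
    rw [detPoly_eq_permSum, permSum]
    refine IsHomogeneous.sum _ _ _ fun π _ => isHomogeneous_monomial _ ?_
    rw [sqfree, map_sum]
    simp [Finsupp.degree_single, offGraph]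
  exact homogeneousComponent_mem_annihilatorIdeal hf hD j

variable {n : ℕ} (ε : k)

/-- In degree two the ideal `(𝒰_D + cross relations)` is just the `k`-span of its generators.
[folklore] -/
private theorem mem_span_of_mem_relIdeal_of_isHomogeneous_two {D : MvPolynomial (Fin n × Fin n) k}
    (hD : D ∈ relIdeal n k ε) (h2 : D.IsHomogeneous 2) :
    D ∈ Submodule.span k (unacceptableQuadrics n k ∪ crossRel n k ε) := by
  classical
  rw [← homogeneousComponent_eq_self h2]
  refine Submodule.span_induction
    (p := fun E _ => homogeneousComponent 2 E ∈ Submodule.span k (unacceptableQuadrics n k ∪ crossRel n k ε))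
    ?_ ?_ ?_ ?_ hD
  · intro q hq
    rw [homogeneousComponent_eq_self (isHomogeneous_two_of_mem_generators ε hq)]
    exact Submodule.subset_span hq
  · rw [map_zero]; exact Submodule.zero_mem _
  · intro x y _ _ hx hy
    rw [map_add]; exact Submodule.add_mem _ hx hy
  · intro r x hx ih
    have hrx : homogeneousComponent 2 (r • x) = coeff 0 r • homogeneousComponent 2 x := by
      ext d
      rw [coeff_homogeneousComponent, coeff_smul, coeff_homogeneousComponent, smul_eq_mul]
      split_ifs with hd
      · rw [smul_eq_mul, coeff_mul, Finset.sum_eq_single (0, d)]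
        · intro p hp hne
          have hp' := Finset.mem_antidiagonal.1 hp
          have h1 : p.1 ≠ 0 := by
            intro h0
            apply hne
            refine Prod.ext h0 ?_
            rw [h0, zero_add] at hp'
            exact hp'
          have hdeg : p.2.degree < 2 := by
            have hsum := congrArg Finsupp.degree hp'
            rw [map_add, hd] at hsum
            have : p.1.degree ≠ 0 := fun h => h1 ((Finsupp.degree_eq_zero_iff _).1 h)
            omega
          rw [coeff_eq_zero_of_mem_relIdeal ε hx hdeg, mul_zero]
        · intro h
          exact absurd (Finset.mem_antidiagonal.2 (zero_add d)) h
      · rw [smul_zero]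
    rw [hrx]
    exact Submodule.smul_mem _ _ ih

/-- Conversely the span of the generators consists of degree-two elements of the ideal. [folklore] -/
private theorem span_le_and_homogeneous {D : MvPolynomial (Fin n × Fin n) k}
    (hD : D ∈ Submodule.span k (unacceptableQuadrics n k ∪ crossRel n k ε)) :
    D.IsHomogeneous 2 ∧ D ∈ relIdeal n k ε := by
  constructor
  · have h : Submodule.span k (unacceptableQuadrics n k ∪ crossRel n k ε) ≤
        homogeneousSubmodule (Fin n × Fin n) k 2 :=
      Submodule.span_le.2 fun q hq => (mem_homogeneousSubmodule _ _).2 (isHomogeneous_two_of_mem_generators ε hq)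
    exact (mem_homogeneousSubmodule _ _).1 (h hD)
  · have h : Submodule.span k (unacceptableQuadrics n k ∪ crossRel n k ε) ≤
        (relIdeal n k ε).restrictScalars k :=
      Submodule.span_le.2 fun q hq => Ideal.subset_span hq
    exact h hD

variable (n) (k)

/-- **Shafiei 2015, Lemma 2.7 (with Remark 1.5 and Cor. 2.4): `Ann(det A) ∩ S_2 = 𝒫_D + 𝒰_D`** as a
vector space — the degree-two annihilator of `det_n` is exactly the `k`-span of the unacceptable
quadrics and the `2 × 2` permanents (Shafiei derives it from the count `dim Ann_2 = dim S_2 − dim 𝓜_A`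
and Lemma 2.6; here from Thm 2.12, over every commutative ring). [cite: Shafiei2015, Lemma 2.7] -/
theorem annihilatorOfDegree_detPoly_two :
    annihilatorOfDegree (detPoly (Fin n) k) 2 =
      (Submodule.span k (unacceptableQuadrics n k ∪ twoByTwoPerms n k) : Set (MvPolynomial (Fin n × Fin n) k)) := by
  ext D
  rw [annihilatorOfDegree_detPoly, ← crossRel_neg_one]
  constructor
  · rintro ⟨h2, hD⟩
    exact mem_span_of_mem_relIdeal_of_isHomogeneous_two (-1) hD h2
  · intro hD
    exact span_le_and_homogeneous (-1) hD

/-- The permanent analogue of Lemma 2.7: `Ann(Per A) ∩ S_2 = ℳ_D + 𝒰_D` as a vector space.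
[cite: Shafiei2015, Lemma 2.7] -/
theorem annihilatorOfDegree_perPoly_two :
    annihilatorOfDegree (perPoly (Fin n) k) 2 =
      (Submodule.span k (unacceptableQuadrics n k ∪ twoByTwoMinors n k) : Set (MvPolynomial (Fin n × Fin n) k)) := by
  ext D
  rw [annihilatorOfDegree_perPoly, ← crossRel_one]
  constructor
  · rintro ⟨h2, hD⟩
    exact mem_span_of_mem_relIdeal_of_isHomogeneous_two 1 hD h2
  · intro hD
    exact span_le_and_homogeneous 1 hD

end Homogeneous

end Literature.Computability.AlgebraicComplexity
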